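import Summits.BirchSwinnertonDyer.Rank1Residual.GaloisImage.ThreeLagrangianCohomology
import Summits.BirchSwinnertonDyer.Rank1Residual.GaloisImage.PadicTwistClassDecider
import Summits.BirchSwinnertonDyer.Rank1Residual.Additive.LocalTowerKernelAtPTwistedOrdinary
import Literature.NumberTheory.EllipticCurves.BSDConductorProofs
import HarnessLib

/-!
# The three-Lagrangian lemma ON `H¹(K_v, E[p])`, II: the `Nat.card` readings (`d_p ∈ {0,2}`,
# `d_p ≠ 1`) and the `K = ℚ`, `p = 3` twin with `#(ℤ₃/3) = 3`, `μ₃(ℚ₃) = 1`, `3 ≠ 2` discharged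
# (cell `b2b-bsdres`, team n1011, seat p12 GEN 11 — TOOL file; row T-K43-COH, FILE 2b;
# skeleton `cells/n1011/skel/T-K43-COH.md`; lead R5-87 (c) / R5-88; referee-1 GEN 37 ACK-1)

HONEST FRAMING (cell `b2b-bsdres`, run/shared/lean/b2b/bsd-rank1-residual/, verbatim in every
file): the goal of the cell is to DELETE the COMBINATION-SHAPED residual classes of the
Birch–Swinnerton-Dyer formula for ALL analytic-rank `≤ 1` elliptic curves over `ℚ` — "full BSD
formula for every rank `≤ 1` curve in class `C`" assembled STRICTLY from published theorems — so
that the rank-`≤ 1` remainder becomes exactly the CONSTRUCTION-SHAPED classes, which are TYPED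
(missing-input `Prop`s), NOT attempted. This is not "finishing BSD". Team n1011 (N10 / N11, the
additive block `X4 ∧ p = 3`): research route on a CONSTRUCTION-SHAPED class; no claim beyond the
stated classes; labels UNCHANGED; nothing is booked; census output = EVIDENCE, never a Literature
fact. TOOL THEOREMS ONLY: no definition, no named fact; closes nothing by itself; every input is a
THEOREM of the tree (FILE 2 `ThreeLagrangianCohomology.exists_threeLagrangian_binders`, p02's
`ThreeLagrangian.natCard_inf_eq_sq_or_eq_one` / `natCard_inf_ne`, p17's
`LocalTorsion3At.forall_pow_three_eq_one_adicCompletion_of_sqFlagAt`, the `ℤ₃/3` count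
`Additive.GoodModelLine.natCard_adicCompletionIntegers_quot_span_eq`).

Setting and displayed binders exactly as in FILE 2 (`kummerLocalConditionAt_eq_or_inf_map_eq_bot`):
odd `p`, `htors : #E(K_v)[p] = p`, `h𝓞 : #(𝓞_v/p) = p`, `hμ : K_v ∌ ζ_p`, `T` a non-zero
`Γ_{K_v}`-fixed point of `E[p]`, the congruence `θ`/`f`, and the `(0,0)` binders `h00`, `h00′`
(pairing-free cocycle form; per-pair EVIDENCE, r1 §42's `A = A′ = 0`; no kernel decider for `A` is
offered or implied). CAVEATS (verbatim): d = 1 only; p ≠ 2; no global statement (nothing here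
decides `d_p = 0` versus `2` — r1's S43-SPLIT / S43-NONSPLIT, records ST-43a/b).
-/

noncomputable section

open scoped Classical
open CategoryTheory Function Field NumberField IsDedekindDomain WeierstrassCurve
  Literature.NumberTheory.EllipticCurves Literature.NumberTheory.GaloisRepresentations
open Literature.NumberTheory.GaloisRepresentations.DiscreteGaloisModule (mu MuCarrier)
open scoped ContRepresentation

namespace Summit.BirchSwinnertonDyer.Rank1Residual.GaloisImage.ThreeLagrangianCoh

/-! ## §1 The `Nat.card` readings: `#(𝓛₁ ⊓ L₂) ∈ {p², 1}`, `≠ p` -/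

section Readings

variable {K : Type} [Field K] [NumberField K] (W W' : WeierstrassCurve K) [W.IsElliptic]
  [W'.IsElliptic] (v : HeightOneSpectrum (𝓞 K)) (p : ℕ) [hp : Fact p.Prime]

/-- **`#(𝓛_v(E) ⊓ θ_*𝓛_v(E′)) ∈ {p², 1}`** (the cost `d_p ∈ {0, 2}` read on cardinalities) under
the hypotheses of `kummerLocalConditionAt_eq_or_inf_map_eq_bot` (same caveats: d = 1 only, p ≠ 2,
no global statement). Via p02's `ThreeLagrangian.natCard_inf_eq_sq_or_eq_one`.
[cite: MilneADT2006, Ch. I, Cor. 2.3 and Thm. 2.8] -/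
theorem natCard_inf_eq_sq_or_eq_one (hp2 : p ≠ 2)
    (htors : Nat.card (nsmulAddMonoidHom p :
      (W.baseChange (v.adicCompletion K)).toAffine.Point →+ _).ker = p)
    (h𝓞 : Nat.card (v.adicCompletionIntegers K ⧸
      Ideal.span {((p : ℕ) : v.adicCompletionIntegers K)}) = p)
    (hμ : ∀ ζ : v.adicCompletion K, ζ ^ p = 1 → ζ = 1)
    (T : geomTorsion W p)
    (hT : ∀ σ : absoluteGaloisGroup (v.adicCompletion K),
      absGaloisRestrict K (v.adicCompletion K) σ • T = T) (hT0 : T ≠ 0)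
    (θ : geomTorsion W' (p : ℤ) ≃+ geomTorsion W (p : ℤ))
    (hθ : ∀ (σ : absoluteGaloisGroup K) (P : geomTorsion W' (p : ℤ)), θ (σ • P) = σ • θ P)
    (f : (GaloisRep.restrictField (v.adicCompletion K)
        (W'.torsionGaloisModule (p : ℤ))).toContRepresentation →ⁱL
      (GaloisRep.restrictField (v.adicCompletion K)
        (W.torsionGaloisModule (p : ℤ))).toContRepresentation)
    (hf : ∀ x, f x = θ x)
    (h00 : ∀ x ∈ W.kummerLocalConditionAt p (v.adicCompletion K),
      (∃ φ : contOneCocycles (GaloisRep.restrictField (v.adicCompletion K)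
          (W.torsionGaloisModule p)).toTopRep,
        oneCocycleClass _ φ = x ∧ ∀ σ, φ.1 σ ∈ AddSubgroup.zmultiples T) → x = 0)
    (h00' : ∀ x ∈ (W'.kummerLocalConditionAt p (v.adicCompletion K)).map (galoisCohomology.map f 1),
      (∃ φ : contOneCocycles (GaloisRep.restrictField (v.adicCompletion K)
          (W.torsionGaloisModule p)).toTopRep,
        oneCocycleClass _ φ = x ∧ ∀ σ, φ.1 σ ∈ AddSubgroup.zmultiples T) → x = 0) :
    Nat.card ↥(W.kummerLocalConditionAt p (v.adicCompletion K) ⊓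
        (W'.kummerLocalConditionAt p (v.adicCompletion K)).map (galoisCohomology.map f 1)) = p ^ 2 ∨
      Nat.card ↥(W.kummerLocalConditionAt p (v.adicCompletion K) ⊓
        (W'.kummerLocalConditionAt p (v.adicCompletion K)).map (galoisCohomology.map f 1)) = 1 := by
  obtain ⟨W₀, q, hqs, hqnd, hH, hWc, hL₁c, hL₂c, hW, hL₁, hL₂, hL₁W, hL₂W⟩ :=
    exists_threeLagrangian_binders W W' v p htors h𝓞 hμ T hT hT0 θ hθ f hf h00 h00'
  exact ThreeLagrangian.natCard_inf_eq_sq_or_eq_one hp2 q hqs hqnd hH hWc hL₁c hL₂c hW hL₁ hL₂ hL₁W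
    hL₂W

/-- **`d_p = 1` is impossible: `#(𝓛_v(E) ⊓ θ_*𝓛_v(E′)) ≠ p`** under the hypotheses of
`kummerLocalConditionAt_eq_or_inf_map_eq_bot` (same caveats). Via p02's
`ThreeLagrangian.natCard_inf_ne`. [cite: MilneADT2006, Ch. I, Cor. 2.3 and Thm. 2.8] -/
theorem natCard_inf_ne (hp2 : p ≠ 2)
    (htors : Nat.card (nsmulAddMonoidHom p :
      (W.baseChange (v.adicCompletion K)).toAffine.Point →+ _).ker = p)
    (h𝓞 : Nat.card (v.adicCompletionIntegers K ⧸
      Ideal.span {((p : ℕ) : v.adicCompletionIntegers K)}) = p)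
    (hμ : ∀ ζ : v.adicCompletion K, ζ ^ p = 1 → ζ = 1)
    (T : geomTorsion W p)
    (hT : ∀ σ : absoluteGaloisGroup (v.adicCompletion K),
      absGaloisRestrict K (v.adicCompletion K) σ • T = T) (hT0 : T ≠ 0)
    (θ : geomTorsion W' (p : ℤ) ≃+ geomTorsion W (p : ℤ))
    (hθ : ∀ (σ : absoluteGaloisGroup K) (P : geomTorsion W' (p : ℤ)), θ (σ • P) = σ • θ P)
    (f : (GaloisRep.restrictField (v.adicCompletion K)
        (W'.torsionGaloisModule (p : ℤ))).toContRepresentation →ⁱL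
      (GaloisRep.restrictField (v.adicCompletion K)
        (W.torsionGaloisModule (p : ℤ))).toContRepresentation)
    (hf : ∀ x, f x = θ x)
    (h00 : ∀ x ∈ W.kummerLocalConditionAt p (v.adicCompletion K),
      (∃ φ : contOneCocycles (GaloisRep.restrictField (v.adicCompletion K)
          (W.torsionGaloisModule p)).toTopRep,
        oneCocycleClass _ φ = x ∧ ∀ σ, φ.1 σ ∈ AddSubgroup.zmultiples T) → x = 0)
    (h00' : ∀ x ∈ (W'.kummerLocalConditionAt p (v.adicCompletion K)).map (galoisCohomology.map f 1),
      (∃ φ : contOneCocycles (GaloisRep.restrictField (v.adicCompletion K)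
          (W.torsionGaloisModule p)).toTopRep,
        oneCocycleClass _ φ = x ∧ ∀ σ, φ.1 σ ∈ AddSubgroup.zmultiples T) → x = 0) :
    Nat.card ↥(W.kummerLocalConditionAt p (v.adicCompletion K) ⊓
        (W'.kummerLocalConditionAt p (v.adicCompletion K)).map (galoisCohomology.map f 1)) ≠ p := by
  obtain ⟨W₀, q, hqs, hqnd, hH, hWc, hL₁c, hL₂c, hW, hL₁, hL₂, hL₁W, hL₂W⟩ :=
    exists_threeLagrangian_binders W W' v p htors h𝓞 hμ T hT hT0 θ hθ f hf h00 h00'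
  exact ThreeLagrangian.natCard_inf_ne hp2 q hqs hqnd hH hWc hL₁c hL₂c hW hL₁ hL₂ hL₁W hL₂W


omit [W'.IsElliptic] hp in
/-- **The `(0,0)` binder of the partner in its OWN currency.** If no non-zero class of `𝓛_v(E′)` is
represented by a `⟨T′⟩`-valued crossed homomorphism (`A(E′) = 0`, r1 §42) and `θ T′ = T`, then no
non-zero class of `θ_* 𝓛_v(E′)` is represented by a `⟨T⟩`-valued one — the END's binder `h00′`.
Transport back along `θ⁻¹` (FILE 1a `exists_rep_zmultiples_map`) and `H¹(θ⁻¹) ∘ H¹(θ) = id` on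
classes. [folklore] -/
theorem forall_map_rep_zmultiples_eq_zero
    (θ : geomTorsion W' (p : ℤ) ≃+ geomTorsion W (p : ℤ))
    (hθ : ∀ (σ : absoluteGaloisGroup K) (P : geomTorsion W' (p : ℤ)), θ (σ • P) = σ • θ P)
    (f : (GaloisRep.restrictField (v.adicCompletion K)
        (W'.torsionGaloisModule (p : ℤ))).toContRepresentation →ⁱL
      (GaloisRep.restrictField (v.adicCompletion K)
        (W.torsionGaloisModule (p : ℤ))).toContRepresentation)
    (hf : ∀ x, f x = θ x) {T : geomTorsion W p} {T' : geomTorsion W' p} (hTT' : θ T' = T)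
    (h0' : ∀ x' ∈ W'.kummerLocalConditionAt p (v.adicCompletion K),
      (∃ φ : contOneCocycles (GaloisRep.restrictField (v.adicCompletion K)
          (W'.torsionGaloisModule p)).toTopRep,
        oneCocycleClass _ φ = x' ∧ ∀ σ, φ.1 σ ∈ AddSubgroup.zmultiples T') → x' = 0) :
    ∀ x ∈ (W'.kummerLocalConditionAt p (v.adicCompletion K)).map (galoisCohomology.map f 1),
      (∃ φ : contOneCocycles (GaloisRep.restrictField (v.adicCompletion K)
          (W.torsionGaloisModule p)).toTopRep,
        oneCocycleClass _ φ = x ∧ ∀ σ, φ.1 σ ∈ AddSubgroup.zmultiples T) → x = 0 := by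
  -- the inverse local map `g = θ⁻¹`
  have hθ' : ∀ (σ : absoluteGaloisGroup K) (P : geomTorsion W (p : ℤ)),
      θ.symm (σ • P) = σ • θ.symm P := fun σ P ↦ by
    apply θ.injective
    rw [AddEquiv.apply_symm_apply, hθ, AddEquiv.apply_symm_apply]
  let gθ : (W.torsionGaloisModule (p : ℤ)).toContRepresentation →ⁱL
      (W'.torsionGaloisModule (p : ℤ)).toContRepresentation :=
    { toContinuousLinearMap := ⟨θ.symm.toAddMonoidHom.toIntLinearMap,
        continuous_of_discreteTopology⟩
      isIntertwining' := fun σ ↦ ContinuousLinearMap.ext fun P ↦ hθ' σ P }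
  let g := gθ.restrictField (v.adicCompletion K)
  have hg : ∀ y, g y = θ.symm y := fun _ ↦ rfl
  have hgf : ∀ x, g (f x) = x := fun x ↦ by rw [hg, hf]; exact θ.symm_apply_apply x
  -- `H¹(g) ∘ H¹(f) = id` on classes
  have hgf1 : ∀ y, galoisCohomology.map g 1 (galoisCohomology.map f 1 y) = y := by
    intro y
    obtain ⟨ψ, rfl⟩ := oneCocycleClass_surjective _ y
    rw [galoisCohomology.map_one_oneCocycleClass, galoisCohomology.map_one_oneCocycleClass]
    refine congrArg _ (Subtype.ext (ContinuousMap.ext fun σ ↦ ?_))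
    rw [contOneCocycles.pullback_apply, contOneCocycles.pullback_apply]
    exact hgf (ψ.1 σ)
  rintro x ⟨x', hx', rfl⟩ hrep
  -- `H¹(g) x` is `⟨g T⟩ = ⟨T′⟩`-represented, and equals `x′`
  obtain ⟨φ, hφ, hφT⟩ := exists_rep_zmultiples_map W' p (v.adicCompletion K) W g T hrep
  have hgT : g T = T' := by rw [hg, ← hTT', θ.symm_apply_apply]
  rw [hgf1] at hφ
  rw [h0' x' hx' ⟨φ, hφ, fun σ ↦ hgT ▸ hφT σ⟩, map_zero]


/-- **`d_p ∈ {0, 2}` with BOTH `(0,0)` binders in their own currencies**: as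
`kummerLocalConditionAt_eq_or_inf_map_eq_bot` (FILE 2), with the partner's binder stated on
`𝓛_v(E′)` and `⟨T′⟩` (`θ T′ = T`) instead of on `θ_* 𝓛_v(E′)` — r1 §42's `A(E) = 0` and `A(E′) = 0`
literally. Same caveats (d = 1 only; p ≠ 2; no global statement; no decider for `A`).
[cite: MilneADT2006, Ch. I, Cor. 2.3 and Thm. 2.8] [cite: PoonenRains2012, Prop. 4.10 (arXiv:1009.0287v2 numbering; = JAMS 25 Prop. 4.11)] -/
theorem kummerLocalConditionAt_eq_or_inf_map_eq_bot_of_partner (hp2 : p ≠ 2)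
    (htors : Nat.card (nsmulAddMonoidHom p :
      (W.baseChange (v.adicCompletion K)).toAffine.Point →+ _).ker = p)
    (h𝓞 : Nat.card (v.adicCompletionIntegers K ⧸
      Ideal.span {((p : ℕ) : v.adicCompletionIntegers K)}) = p)
    (hμ : ∀ ζ : v.adicCompletion K, ζ ^ p = 1 → ζ = 1)
    (T : geomTorsion W p)
    (hT : ∀ σ : absoluteGaloisGroup (v.adicCompletion K),
      absGaloisRestrict K (v.adicCompletion K) σ • T = T) (hT0 : T ≠ 0)
    (θ : geomTorsion W' (p : ℤ) ≃+ geomTorsion W (p : ℤ))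
    (hθ : ∀ (σ : absoluteGaloisGroup K) (P : geomTorsion W' (p : ℤ)), θ (σ • P) = σ • θ P)
    (f : (GaloisRep.restrictField (v.adicCompletion K)
        (W'.torsionGaloisModule (p : ℤ))).toContRepresentation →ⁱL
      (GaloisRep.restrictField (v.adicCompletion K)
        (W.torsionGaloisModule (p : ℤ))).toContRepresentation)
    (hf : ∀ x, f x = θ x) (T' : geomTorsion W' p) (hTT' : θ T' = T)
    (h00 : ∀ x ∈ W.kummerLocalConditionAt p (v.adicCompletion K),
      (∃ φ : contOneCocycles (GaloisRep.restrictField (v.adicCompletion K)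
          (W.torsionGaloisModule p)).toTopRep,
        oneCocycleClass _ φ = x ∧ ∀ σ, φ.1 σ ∈ AddSubgroup.zmultiples T) → x = 0)
    (h0' : ∀ x' ∈ W'.kummerLocalConditionAt p (v.adicCompletion K),
      (∃ φ : contOneCocycles (GaloisRep.restrictField (v.adicCompletion K)
          (W'.torsionGaloisModule p)).toTopRep,
        oneCocycleClass _ φ = x' ∧ ∀ σ, φ.1 σ ∈ AddSubgroup.zmultiples T') → x' = 0) :
    W.kummerLocalConditionAt p (v.adicCompletion K) =
        (W'.kummerLocalConditionAt p (v.adicCompletion K)).map (galoisCohomology.map f 1) ∨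
      W.kummerLocalConditionAt p (v.adicCompletion K) ⊓
        (W'.kummerLocalConditionAt p (v.adicCompletion K)).map (galoisCohomology.map f 1) = ⊥ :=
  kummerLocalConditionAt_eq_or_inf_map_eq_bot W W' v p hp2 htors h𝓞 hμ T hT hT0 θ hθ f hf h00
    (forall_map_rep_zmultiples_eq_zero W W' v p θ hθ f hf hTT' h0')


/-- **`d_p ∈ {0, 2}`, records-friendly form: no generator `T` named.** As
`kummerLocalConditionAt_eq_or_inf_map_eq_bot` (FILE 2), with the `(0,0)` binders quantified over
EVERY `Γ_{K_v}`-fixed `T ∈ E[p]` (for `T = 0` they are vacuous; for `T ≠ 0` they are r1 §42's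
`A(E) = 0`, `A(E′) = 0` read on `θ_*𝓛_v(E′)`), so that a record supplies only the census bit
`htors : #E(K_v)[p] = p` and never a point of `E[p](K̄)`: a non-zero fixed `T` EXISTS because the
fixed points of `E[p]` are in bijection with `E(K_v)[p]` (Galois descent,
`NonsplitKummer.natCard_ker_nsmul_eq_natCard_fixed`), of order `p > 1`. Same caveats (d = 1 only;
p ≠ 2; no global statement; no decider for `A`).
[cite: MilneADT2006, Ch. I, Cor. 2.3 and Thm. 2.8] [cite: PoonenRains2012, Prop. 4.10 (arXiv:1009.0287v2 numbering; = JAMS 25 Prop. 4.11)] -/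
theorem kummerLocalConditionAt_eq_or_inf_map_eq_bot_of_forall_fixed (hp2 : p ≠ 2)
    (htors : Nat.card (nsmulAddMonoidHom p :
      (W.baseChange (v.adicCompletion K)).toAffine.Point →+ _).ker = p)
    (h𝓞 : Nat.card (v.adicCompletionIntegers K ⧸
      Ideal.span {((p : ℕ) : v.adicCompletionIntegers K)}) = p)
    (hμ : ∀ ζ : v.adicCompletion K, ζ ^ p = 1 → ζ = 1)
    (θ : geomTorsion W' (p : ℤ) ≃+ geomTorsion W (p : ℤ))
    (hθ : ∀ (σ : absoluteGaloisGroup K) (P : geomTorsion W' (p : ℤ)), θ (σ • P) = σ • θ P)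
    (f : (GaloisRep.restrictField (v.adicCompletion K)
        (W'.torsionGaloisModule (p : ℤ))).toContRepresentation →ⁱL
      (GaloisRep.restrictField (v.adicCompletion K)
        (W.torsionGaloisModule (p : ℤ))).toContRepresentation)
    (hf : ∀ x, f x = θ x)
    (h00 : ∀ T : geomTorsion W p, (∀ σ : absoluteGaloisGroup (v.adicCompletion K),
        absGaloisRestrict K (v.adicCompletion K) σ • T = T) →
      ∀ x ∈ W.kummerLocalConditionAt p (v.adicCompletion K),
        (∃ φ : contOneCocycles (GaloisRep.restrictField (v.adicCompletion K)
            (W.torsionGaloisModule p)).toTopRep,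
          oneCocycleClass _ φ = x ∧ ∀ σ, φ.1 σ ∈ AddSubgroup.zmultiples T) → x = 0)
    (h00' : ∀ T : geomTorsion W p, (∀ σ : absoluteGaloisGroup (v.adicCompletion K),
        absGaloisRestrict K (v.adicCompletion K) σ • T = T) →
      ∀ x ∈ (W'.kummerLocalConditionAt p (v.adicCompletion K)).map (galoisCohomology.map f 1),
        (∃ φ : contOneCocycles (GaloisRep.restrictField (v.adicCompletion K)
            (W.torsionGaloisModule p)).toTopRep,
          oneCocycleClass _ φ = x ∧ ∀ σ, φ.1 σ ∈ AddSubgroup.zmultiples T) → x = 0) :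
    W.kummerLocalConditionAt p (v.adicCompletion K) =
        (W'.kummerLocalConditionAt p (v.adicCompletion K)).map (galoisCohomology.map f 1) ∨
      W.kummerLocalConditionAt p (v.adicCompletion K) ⊓
        (W'.kummerLocalConditionAt p (v.adicCompletion K)).map (galoisCohomology.map f 1) = ⊥ := by
  haveI : CharZero (v.adicCompletion K) := charZero_adicCompletion v
  -- a non-zero `Γ_{K_v}`-fixed point of `E[p]` exists: `#{fixed} = #E(K_v)[p] = p > 1`
  have hfix : Nat.card {T : geomTorsion W (p : ℤ) //
      ∀ σ : absoluteGaloisGroup (v.adicCompletion K),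
        absGaloisRestrict K (v.adicCompletion K) σ • T = T} = p := by
    rw [← NonsplitKummer.natCard_ker_nsmul_eq_natCard_fixed W, htors]
  haveI : Finite {T : geomTorsion W (p : ℤ) //
      ∀ σ : absoluteGaloisGroup (v.adicCompletion K),
        absGaloisRestrict K (v.adicCompletion K) σ • T = T} :=
    Nat.finite_of_card_ne_zero (by rw [hfix]; exact hp.out.ne_zero)
  obtain ⟨a, b, hab⟩ := Finite.one_lt_card_iff_nontrivial.mp (hfix ▸ hp.out.one_lt)
  -- one of `a`, `b` is non-zero
  obtain ⟨T, hT, hT0⟩ : ∃ T : geomTorsion W (p : ℤ),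
      (∀ σ : absoluteGaloisGroup (v.adicCompletion K),
        absGaloisRestrict K (v.adicCompletion K) σ • T = T) ∧ T ≠ 0 := by
    by_cases ha : (a : geomTorsion W (p : ℤ)) = 0
    · refine ⟨b, b.2, fun hb ↦ hab (Subtype.ext (ha.trans hb.symm))⟩
    · exact ⟨a, a.2, ha⟩
  exact kummerLocalConditionAt_eq_or_inf_map_eq_bot W W' v p hp2 htors h𝓞 hμ T hT hT0 θ hθ f hf
    (h00 T hT) (h00' T hT)

end Readings

/-! ## §3 The `K = ℚ`, `p = 3` twin: `h𝓞`, `hμ`, `hp2` discharged -/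

section Rat

open Rat.HeightOneSpectrum

variable (W W' : WeierstrassCurve ℚ) [W.IsElliptic] [W'.IsElliptic] {v : HeightOneSpectrum (𝓞 ℚ)}

/-- **`d₃ ∈ {0, 2}` at the place `3` of `ℚ` for a `3`-congruence in regime `(0,0)` with `t₃ = 3`**
(r1 ROUTE-1 §43.1 COROLLARY, the N11 / K43 setting): the twin of
`kummerLocalConditionAt_eq_or_inf_map_eq_bot` over `ℚ` at `v = 3` with `#(ℤ₃/3) = 3`
(`Additive.GoodModelLine.natCard_adicCompletionIntegers_quot_span_eq`), `μ₃(ℚ₃) = 1` (p17's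
`LocalTorsion3At.forall_pow_three_eq_one_adicCompletion_of_sqFlagAt`: `−3` is not a square in `ℚ₃`,
square-flag data `decide`d) and `3 ≠ 2` discharged. Displayed: `t₃ = 3` (`htors`), the generator `T`,
the congruence `θ`/`f`, and the `(0,0)` binders `h00 h00′` (EVIDENCE, r1 §42's `A = A′ = 0`).
Caveats as there (no decider for `d₃ = 0` vs `2`; no global statement).
[cite: MilneADT2006, Ch. I, Cor. 2.3 and Thm. 2.8] [cite: PoonenRains2012, Prop. 4.10 (arXiv:1009.0287v2 numbering; = JAMS 25 Prop. 4.11)] -/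
theorem kummerLocalConditionAt_eq_or_inf_map_eq_bot_three (hv : (primesEquiv v : ℕ) = 3)
    (htors : Nat.card (nsmulAddMonoidHom 3 :
      (W.baseChange (v.adicCompletion ℚ)).toAffine.Point →+ _).ker = 3)
    (T : geomTorsion W (3 : ℕ))
    (hT : ∀ σ : absoluteGaloisGroup (v.adicCompletion ℚ),
      absGaloisRestrict ℚ (v.adicCompletion ℚ) σ • T = T) (hT0 : T ≠ 0)
    (θ : geomTorsion W' ((3 : ℕ) : ℤ) ≃+ geomTorsion W ((3 : ℕ) : ℤ))
    (hθ : ∀ (σ : absoluteGaloisGroup ℚ) (P : geomTorsion W' ((3 : ℕ) : ℤ)), θ (σ • P) = σ • θ P)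
    (f : (GaloisRep.restrictField (v.adicCompletion ℚ)
        (W'.torsionGaloisModule ((3 : ℕ) : ℤ))).toContRepresentation →ⁱL
      (GaloisRep.restrictField (v.adicCompletion ℚ)
        (W.torsionGaloisModule ((3 : ℕ) : ℤ))).toContRepresentation)
    (hf : ∀ x, f x = θ x)
    (h00 : ∀ x ∈ W.kummerLocalConditionAt (3 : ℕ) (v.adicCompletion ℚ),
      (∃ φ : contOneCocycles (GaloisRep.restrictField (v.adicCompletion ℚ)
          (W.torsionGaloisModule (3 : ℕ))).toTopRep,
        oneCocycleClass _ φ = x ∧ ∀ σ, φ.1 σ ∈ AddSubgroup.zmultiples T) → x = 0)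
    (h00' : ∀ x ∈ (W'.kummerLocalConditionAt (3 : ℕ) (v.adicCompletion ℚ)).map
        (galoisCohomology.map f 1),
      (∃ φ : contOneCocycles (GaloisRep.restrictField (v.adicCompletion ℚ)
          (W.torsionGaloisModule (3 : ℕ))).toTopRep,
        oneCocycleClass _ φ = x ∧ ∀ σ, φ.1 σ ∈ AddSubgroup.zmultiples T) → x = 0) :
    W.kummerLocalConditionAt (3 : ℕ) (v.adicCompletion ℚ) =
        (W'.kummerLocalConditionAt (3 : ℕ) (v.adicCompletion ℚ)).map (galoisCohomology.map f 1) ∨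
      W.kummerLocalConditionAt (3 : ℕ) (v.adicCompletion ℚ) ⊓
        (W'.kummerLocalConditionAt (3 : ℕ) (v.adicCompletion ℚ)).map (galoisCohomology.map f 1)
          = ⊥ := by
  haveI : Fact (Nat.Prime 3) := ⟨Nat.prime_three⟩
  have hpv : ((3 : ℕ) : 𝓞 ℚ) ∈ v.asIdeal := by
    rw [natCast_mem_asIdeal_iff_eq_primesEquiv_symm v Nat.prime_three, Equiv.eq_symm_apply]
    exact Subtype.ext hv
  have h𝓞 := Additive.GoodModelLine.natCard_adicCompletionIntegers_quot_span_eq (p := 3) hpv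
  have hμ : ∀ ζ : v.adicCompletion ℚ, ζ ^ 3 = 1 → ζ = 1 :=
    LocalTorsion3At.forall_pow_three_eq_one_adicCompletion_of_sqFlagAt v hv (w₃ := 1)
      (by decide) (by decide) (by decide)
  exact kummerLocalConditionAt_eq_or_inf_map_eq_bot W W' v 3 (by decide) htors h𝓞 hμ T hT hT0 θ hθ f hf
    h00 h00'

/-- **`d₃ ∈ {0, 2}` at the place `3` of `ℚ`, records-friendly form** (no point of `E[3](ℚ̄)` named):
the `K = ℚ`, `p = 3` twin of `kummerLocalConditionAt_eq_or_inf_map_eq_bot_of_forall_fixed` — a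
record supplies `hv` (the place `3`), the census bit `htors : #E(ℚ₃)[3] = 3` (`t₃ = 3`), the
congruence `θ`/`f`, and the two `(0,0)` binders quantified over every `Γ_{ℚ₃}`-fixed `T`
(EVIDENCE, r1 §42's `A = A′ = 0`; no kernel decider offered); `#(ℤ₃/3) = 3`, `μ₃(ℚ₃) = 1` and
`3 ≠ 2` are discharged here. Caveats as in FILE 2 (no decider for `d₃ = 0` vs `2`; no global
statement). [cite: MilneADT2006, Ch. I, Cor. 2.3 and Thm. 2.8] -/
theorem kummerLocalConditionAt_eq_or_inf_map_eq_bot_three_of_forall_fixed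
    (hv : (primesEquiv v : ℕ) = 3)
    (htors : Nat.card (nsmulAddMonoidHom 3 :
      (W.baseChange (v.adicCompletion ℚ)).toAffine.Point →+ _).ker = 3)
    (θ : geomTorsion W' ((3 : ℕ) : ℤ) ≃+ geomTorsion W ((3 : ℕ) : ℤ))
    (hθ : ∀ (σ : absoluteGaloisGroup ℚ) (P : geomTorsion W' ((3 : ℕ) : ℤ)), θ (σ • P) = σ • θ P)
    (f : (GaloisRep.restrictField (v.adicCompletion ℚ)
        (W'.torsionGaloisModule ((3 : ℕ) : ℤ))).toContRepresentation →ⁱL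
      (GaloisRep.restrictField (v.adicCompletion ℚ)
        (W.torsionGaloisModule ((3 : ℕ) : ℤ))).toContRepresentation)
    (hf : ∀ x, f x = θ x)
    (h00 : ∀ T : geomTorsion W (3 : ℕ), (∀ σ : absoluteGaloisGroup (v.adicCompletion ℚ),
        absGaloisRestrict ℚ (v.adicCompletion ℚ) σ • T = T) →
      ∀ x ∈ W.kummerLocalConditionAt (3 : ℕ) (v.adicCompletion ℚ),
        (∃ φ : contOneCocycles (GaloisRep.restrictField (v.adicCompletion ℚ)
            (W.torsionGaloisModule (3 : ℕ))).toTopRep,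
          oneCocycleClass _ φ = x ∧ ∀ σ, φ.1 σ ∈ AddSubgroup.zmultiples T) → x = 0)
    (h00' : ∀ T : geomTorsion W (3 : ℕ), (∀ σ : absoluteGaloisGroup (v.adicCompletion ℚ),
        absGaloisRestrict ℚ (v.adicCompletion ℚ) σ • T = T) →
      ∀ x ∈ (W'.kummerLocalConditionAt (3 : ℕ) (v.adicCompletion ℚ)).map
          (galoisCohomology.map f 1),
        (∃ φ : contOneCocycles (GaloisRep.restrictField (v.adicCompletion ℚ)
            (W.torsionGaloisModule (3 : ℕ))).toTopRep,
          oneCocycleClass _ φ = x ∧ ∀ σ, φ.1 σ ∈ AddSubgroup.zmultiples T) → x = 0) :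
    W.kummerLocalConditionAt (3 : ℕ) (v.adicCompletion ℚ) =
        (W'.kummerLocalConditionAt (3 : ℕ) (v.adicCompletion ℚ)).map (galoisCohomology.map f 1) ∨
      W.kummerLocalConditionAt (3 : ℕ) (v.adicCompletion ℚ) ⊓
        (W'.kummerLocalConditionAt (3 : ℕ) (v.adicCompletion ℚ)).map (galoisCohomology.map f 1)
          = ⊥ := by
  haveI : Fact (Nat.Prime 3) := ⟨Nat.prime_three⟩
  have hpv : ((3 : ℕ) : 𝓞 ℚ) ∈ v.asIdeal := by
    rw [natCast_mem_asIdeal_iff_eq_primesEquiv_symm v Nat.prime_three, Equiv.eq_symm_apply]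
    exact Subtype.ext hv
  exact kummerLocalConditionAt_eq_or_inf_map_eq_bot_of_forall_fixed W W' v 3 (by decide) htors
    (Additive.GoodModelLine.natCard_adicCompletionIntegers_quot_span_eq (p := 3) hpv)
    (LocalTorsion3At.forall_pow_three_eq_one_adicCompletion_of_sqFlagAt v hv (w₃ := 1)
      (by decide) (by decide) (by decide)) θ hθ f hf h00 h00'

end Rat

end Summit.BirchSwinnertonDyer.Rank1Residual.GaloisImage.ThreeLagrangianCoh

end
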